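import Summits.AtomisticToContinuum.Crystallization.Theses.HullExactificationCascade
import Summits.AtomisticToContinuum.Crystallization.Theorems.HullExactificationCascadeHullGoodEverywhereBonded
import HarnessLib

/-!
# Two-shell spread (stub `stub_twoShellSpread` of the birth line of crux `ZeroDefectDensity`,
# route `HullExactificationCascade`, item stmt-AtomisticToContinuum-12086)

The COUNTING step of the line "radial order, then orientational order, two shells deep": for a
sequence of Lennard-Jones ground states `x N` in `ℝ³`, if the fraction of particles that are not
RADIALLY TIGHT (with `dᵢ` the nearest-neighbour distance of `i` and `T` the other particles within
`13/10 · dᵢ`: `#T = 12` and all of `T` within `21/20 · dᵢ`) tends to `0`, then so does the fraction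
of particles that are not radially tight TWO SHELLS DEEP (`i` itself and every particle within
`13/5 · dᵢ` of `x N i` radially tight).

Proof (charging).  A particle `i` that is radially tight but has a non-tight particle `j` within
`13/5 · dᵢ` is charged to `j`.  By the bondedness radius `R₀` of ground states
(`hge_exists_bond_radius`: for `N ≥ 2` every particle has another one within `R₀`) the
nearest-neighbour distance satisfies `dᵢ ≤ R₀`, so `|xᵢ - xⱼ| ≤ 13/5 · R₀`; by the uniform minimal
distance `δ` (`LennardJonesMinimalDistance_holds`) and the packing bound
`card_le_of_separated_of_dist_le`, each `j` is charged at most `K = (2 · (13/5 · R₀)/δ + 1)³` times.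
Hence `#¬TwoShellTight ≤ (1 + K) · #¬RadialTight` for every `N`, and `squeeze_zero` concludes.

Contents: `tss_card_le_of_dist_le` (packing count), `tss_card_le_of_charging` (the charging
inequality on finsets), `tss_sInf_le` (nearest-neighbour distance is at most any realised distance),
`tss_cover` (a non-two-shell-tight site is non-tight or near a non-tight site), `tss_key_bound`
(the bound `#¬TST ≤ (1 + K) · #¬RT`, generic in the pointwise predicate), `stub_twoShellSpread`
(the registered signature, verbatim).
-/

noncomputable section

namespace Summit.AtomisticToContinuum.Crystallization.Theorems.ZeroDefectDensityBirth

open Filter Topology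
open Literature.MathematicalPhysics.StatisticalMechanics

/-! ## Packing and charging -/

/-- **Packing count.** For an injective, `δ`-separated configuration `y` of `ℝ³` and a finset `F`
of indices whose points all lie within distance `R ≥ 0` of a centre `c`, `#F ≤ (2R/δ + 1)³`
(`card_le_of_separated_of_dist_le` applied to `F.image y`, `finrank ℝ ℝ³ = 3`). [folklore] -/
theorem tss_card_le_of_dist_le {N : ℕ} (y : Fin N → EuclideanSpace ℝ (Fin 3))
    (hy : Function.Injective y) {δ : ℝ} (hδ : 0 < δ)
    (hsep : ∀ i j, i ≠ j → δ ≤ dist (y i) (y j)) (c : EuclideanSpace ℝ (Fin 3)) {R : ℝ}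
    (hR : 0 ≤ R) (F : Finset (Fin N)) (hF : ∀ j ∈ F, dist (y j) c ≤ R) :
    (F.card : ℝ) ≤ (2 * R / δ + 1) ^ 3 := by
  classical
  have hcard : (F.image y).card = F.card := Finset.card_image_of_injective _ hy
  have h := card_le_of_separated_of_dist_le (F.image y) c hδ hR ?_ ?_
  · rw [hcard, finrank_euclideanSpace_fin] at h
    exact h
  · intro p hp
    obtain ⟨j, hj, rfl⟩ := Finset.mem_image.1 hp
    exact hF j hj
  · intro p hp q hq hpq
    obtain ⟨j, -, rfl⟩ := Finset.mem_image.1 hp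
    obtain ⟨j', -, rfl⟩ := Finset.mem_image.1 hq
    exact hsep j j' fun hjj' => hpq (by rw [hjj'])

/-- **Charging inequality.** If every element of `C` lies in `B` or in the neighbourhood `near j`
of some `j ∈ B`, and every neighbourhood has at most `K` elements, then `#C ≤ (1 + K) · #B`
(`C ⊆ B ∪ ⋃_{j ∈ B} near j`, `Finset.card_biUnion_le`). [folklore] -/
theorem tss_card_le_of_charging {N : ℕ} (B C : Finset (Fin N)) (near : Fin N → Finset (Fin N))
    {K : ℝ} (hcover : ∀ i ∈ C, i ∈ B ∨ ∃ j ∈ B, i ∈ near j)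
    (hmult : ∀ j, ((near j).card : ℝ) ≤ K) :
    (C.card : ℝ) ≤ (1 + K) * (B.card : ℝ) := by
  classical
  have hsub : C ⊆ B ∪ B.biUnion near := by
    intro i hi
    rcases hcover i hi with h | ⟨j, hj, hij⟩
    · exact Finset.mem_union_left _ h
    · exact Finset.mem_union_right _ (Finset.mem_biUnion.2 ⟨j, hj, hij⟩)
  have h1 : C.card ≤ B.card + (B.biUnion near).card :=
    (Finset.card_le_card hsub).trans (Finset.card_union_le _ _)
  have h2 : (B.biUnion near).card ≤ ∑ j ∈ B, (near j).card := Finset.card_biUnion_le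
  have h3 : (∑ j ∈ B, ((near j).card : ℝ)) ≤ ∑ j ∈ B, K :=
    Finset.sum_le_sum fun j _ => hmult j
  rw [Finset.sum_const, nsmul_eq_mul] at h3
  have h12 : (C.card : ℝ) ≤ (B.card : ℝ) + ∑ j ∈ B, ((near j).card : ℝ) := by
    exact_mod_cast h1.trans (Nat.add_le_add_left h2 _)
  linarith

/-! ## The nearest-neighbour distance and the cover -/

/-- The nearest-neighbour distance `sInf {dist z (y i) | z ∈ range y ∖ {y i}}` of particle `i` of an
injective configuration is at most the distance to any other particle `k ≠ i` (`csInf_le`, the set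
being bounded below by `0`). [folklore] -/
theorem tss_sInf_le {N : ℕ} (y : Fin N → EuclideanSpace ℝ (Fin 3)) (hy : Function.Injective y)
    {i k : Fin N} (hki : k ≠ i) :
    sInf ((fun z => dist z (y i)) '' (Set.range y \ {y i})) ≤ dist (y i) (y k) := by
  rw [dist_comm (y i) (y k)]
  refine csInf_le ⟨0, ?_⟩ ⟨y k, ⟨Set.mem_range_self k, fun h => hki (hy h)⟩, rfl⟩
  rintro _ ⟨z, -, rfl⟩
  exact dist_nonneg

/-- **Cover.** In an injective configuration `y` in which every particle `i` (as soon as there is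
another particle) has a partner within `R₀`, a particle `i` that fails "`P` at `y i` and `P` at
every particle within `13/5 · dᵢ` of `y i`" (`dᵢ` the nearest-neighbour distance) either fails `P`
itself or lies within `13/5 · R₀` of a particle failing `P` (since then `dᵢ ≤ R₀`). [folklore] -/
theorem tss_cover {N : ℕ} (y : Fin N → EuclideanSpace ℝ (Fin 3)) (hy : Function.Injective y)
    {R₀ : ℝ} (hbond : ∀ i j : Fin N, j ≠ i → ∃ k : Fin N, k ≠ i ∧ dist (y i) (y k) ≤ R₀)
    (P : EuclideanSpace ℝ (Fin 3) → Prop) (i : Fin N)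
    (hi : ¬ (P (y i) ∧ ∀ z ∈ Set.range y,
      dist z (y i) < 13 / 5 * sInf ((fun z => dist z (y i)) '' (Set.range y \ {y i})) → P z)) :
    ¬ P (y i) ∨ ∃ j : Fin N, ¬ P (y j) ∧ dist (y i) (y j) ≤ 13 / 5 * R₀ := by
  by_cases hPi : P (y i)
  · refine Or.inr ?_
    by_contra hcon
    refine hi ⟨hPi, ?_⟩
    rintro z ⟨j, rfl⟩ hdist
    by_contra hPj
    have hji : j ≠ i := by
      rintro rfl
      exact hPj hPi
    obtain ⟨k, hki, hk⟩ := hbond i j hji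
    have hd : sInf ((fun z => dist z (y i)) '' (Set.range y \ {y i})) ≤ R₀ :=
      (tss_sInf_le y hy hki).trans hk
    refine hcon ⟨j, hPj, ?_⟩
    rw [dist_comm (y i) (y j)]
    linarith
  · exact Or.inl hPi

/-! ## The key bound -/

/-- **Key bound** (generic in the pointwise predicate `P`, here "radially tight at the point").
For an injective, `δ`-separated configuration with bond radius `R₀`, the number of particles that
fail "`P` two shells deep" (`P` at `y i` and at every particle within `13/5 · dᵢ`) is at most
`(1 + (2 · (13/5 · R₀)/δ + 1)³)` times the number of particles failing `P`: charge to a nearby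
`P`-failing particle (`tss_cover`) and count the charges by packing (`tss_card_le_of_dist_le`).
[folklore] -/
theorem tss_key_bound {N : ℕ} (y : Fin N → EuclideanSpace ℝ (Fin 3)) (hy : Function.Injective y)
    {δ R₀ : ℝ} (hδ : 0 < δ) (hR₀ : 0 < R₀) (hsep : ∀ i j, i ≠ j → δ ≤ dist (y i) (y j))
    (hbond : ∀ i j : Fin N, j ≠ i → ∃ k : Fin N, k ≠ i ∧ dist (y i) (y k) ≤ R₀)
    (P : EuclideanSpace ℝ (Fin 3) → Prop) :
    (Nat.card {i : Fin N // ¬ (P (y i) ∧ ∀ z ∈ Set.range y,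
        dist z (y i) < 13 / 5 * sInf ((fun z => dist z (y i)) '' (Set.range y \ {y i})) → P z)} : ℝ)
      ≤ (1 + (2 * (13 / 5 * R₀) / δ + 1) ^ 3) * (Nat.card {i : Fin N // ¬ P (y i)} : ℝ) := by
  classical
  simp only [Nat.card_eq_fintype_card, Fintype.card_subtype]
  refine tss_card_le_of_charging _ _
    (fun j => Finset.univ.filter fun i => dist (y i) (y j) ≤ 13 / 5 * R₀) ?_ ?_
  · intro i hi
    rcases tss_cover y hy hbond P i (Finset.mem_filter.1 hi).2 with h | ⟨j, hj, hij⟩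
    · exact Or.inl (Finset.mem_filter.2 ⟨Finset.mem_univ _, h⟩)
    · exact Or.inr ⟨j, Finset.mem_filter.2 ⟨Finset.mem_univ _, hj⟩,
        Finset.mem_filter.2 ⟨Finset.mem_univ _, hij⟩⟩
  · intro j
    exact tss_card_le_of_dist_le y hy hδ hsep (y j) (by positivity) _
      fun i hi => (Finset.mem_filter.1 hi).2

/-! ## The registered stub -/

/-- **Two-shell spread** (stub `stub_twoShellSpread` of the birth line of crux `ZeroDefectDensity`,
the registered signature in its `let`-free, zeta-inlined form).  For sequences of Lennard-Jones
ground states in `ℝ³`, radial order a.e. implies radial order TWO SHELLS DEEP a.e.: with the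
uniform minimal distance `δ`
(`LennardJonesMinimalDistance_holds`) and the bond radius `R₀` (`hge_exists_bond_radius`),
`#¬TwoShellTight ≤ (1 + (2 · (13/5 · R₀)/δ + 1)³) · #¬RadialTight` for every `N`
(`tss_key_bound`), and `squeeze_zero`. [folklore] -/
theorem stub_twoShellSpread : ∀ (x : (N : ℕ) → (Fin N → EuclideanSpace ℝ (Fin 3))), (∀ N, Literature.MathematicalPhysics.StatisticalMechanics.IsGroundState Literature.MathematicalPhysics.StatisticalMechanics.lennardJones (x N)) → Filter.Tendsto (fun N : ℕ => (Nat.card {i : Fin N // ¬ (Nat.card ↥{w : EuclideanSpace ℝ (Fin 3) | w ∈ Set.range (x N) ∧ w ≠ (x N i) ∧ dist w (x N i) < 13 / 10 * sInf ((fun w => dist w (x N i)) '' (Set.range (x N) \ {(x N i)}))} = 12 ∧ ∀ w ∈ {w : EuclideanSpace ℝ (Fin 3) | w ∈ Set.range (x N) ∧ w ≠ (x N i) ∧ dist w (x N i) < 13 / 10 * sInf ((fun w => dist w (x N i)) '' (Set.range (x N) \ {(x N i)}))}, dist w (x N i) ≤ 21 / 20 * sInf ((fun w => dist w (x N i)) ''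 (Set.range (x N) \ {(x N i)})))} : ℝ) / (N : ℝ)) Filter.atTop (nhds (0 : ℝ)) → Filter.Tendsto (fun N : ℕ => (Nat.card {i : Fin N // ¬ ((Nat.card ↥{w : EuclideanSpace ℝ (Fin 3) | w ∈ Set.range (x N) ∧ w ≠ (x N i) ∧ dist w (x N i) < 13 / 10 * sInf ((fun w => dist w (x N i)) '' (Set.range (x N) \ {(x N i)}))} = 12 ∧ ∀ w ∈ {w : EuclideanSpace ℝ (Fin 3) | w ∈ Set.range (x N) ∧ w ≠ (x N i) ∧ dist w (x N i) < 13 / 10 * sInf ((fun w => dist w (x N i)) '' (Set.range (x N) \ {(x N i)}))}, dist w (x N i) ≤ 21 / 20 * sInf ((fun w => dist w (x N i)) '' (Set.range (x N) \ {(x N i)}))) ∧ ∀ z ∈ Set.range (x N), dist z (x N i) < 13 / 5 * sInf ((fun w => dist w (x N i)) '' (Set.range (x N) \ {(x N i)})) → (Nat.card ↥{w : EuclideanSpace ℝ (Fin 3) | w ∈ Set.range (x N) ∧ w ≠ z ∧ dist w z < 13 / 10 * sInf ((fun w => dist w z) '' (Set.range (x N) \ {z}))} = 12 ∧ ∀ w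 ∈ {w : EuclideanSpace ℝ (Fin 3) | w ∈ Set.range (x N) ∧ w ≠ z ∧ dist w z < 13 / 10 * sInf ((fun w => dist w z) '' (Set.range (x N) \ {z}))}, dist w z ≤ 21 / 20 * sInf ((fun w => dist w z) '' (Set.range (x N) \ {z}))))} : ℝ) / (N : ℝ)) Filter.atTop (nhds (0 : ℝ)) := by
  intro x hx h
  obtain ⟨δ, hδ, hsep⟩ :=
    Literature.MathematicalPhysics.StatisticalMechanics.LennardJonesMinimalDistance_holds
  obtain ⟨R₀, hR₀, hbond⟩ :=
    Summit.AtomisticToContinuum.Crystallization.Theorems.hge_exists_bond_radius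
  have h2 := h.const_mul (1 + (2 * (13 / 5 * R₀) / δ + 1) ^ 3)
  rw [mul_zero] at h2
  refine squeeze_zero (fun N => by positivity) (fun N => ?_) h2
  have hk := div_le_div_of_nonneg_right (tss_key_bound (x N) (hx N).1 hδ hR₀
    (hsep N (x N) (hx N)) (hbond N (x N) (hx N))
    (fun p => (let d₁ : ℝ := sInf ((fun w => dist w p) '' (Set.range (x N) \ {p}));
      let T₁ : Set (EuclideanSpace ℝ (Fin 3)) :=
        {w : EuclideanSpace ℝ (Fin 3) | w ∈ Set.range (x N) ∧ w ≠ p ∧ dist w p < 13 / 10 * d₁};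
      Nat.card ↥T₁ = 12 ∧ ∀ w ∈ T₁, dist w p ≤ 21 / 20 * d₁))) (Nat.cast_nonneg N)
  rw [mul_div_assoc] at hk
  exact hk

end Summit.AtomisticToContinuum.Crystallization.Theorems.ZeroDefectDensityBirth

end
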